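import Mathlib.Combinatorics.SimpleGraph.Operations
import Summits.CriticalPhenomena.SAWScalingLimit.Theorems.SAWTotalPositivityBoundaryTP2Kernel
import Summits.CriticalPhenomena.SAWScalingLimit.Theorems.SAWTotalPositivityBoundaryTP2Symmetry
import HarnessLib

/-!
# `InterlacedTP2At x →` three-point splitting: the one-pendant trick

Crux `LeftRightFKG` (stmt-CriticalPhenomena-11232), line `corner-localisation`, skeleton v7, registered stub
`stub_threePointOfInterlaced` — the converse direction of the decomposition
`InterlacedTP2At x ↔ GraphTP2At x ∧ ThreePoint(x)` (the direction `⟸` is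
`…Theorems/SAWLeftRightFKGLeftRightFKGInterlacedOfGraphTP2.lean`).

CLAIM (`threePoint_of_interlacedTP2At`). Let `0 < x` and assume `BoundaryTP2.InterlacedTP2At x`. Let
`H ≤ zdGraph 2` have finitely many non-isolated vertices, let `w ∼ w'` be a lattice edge whose endpoint `w'` is
isolated in `H`, and let `w, p, q` be pairwise distinct. Then, with `Z_H = BoundaryTP2.pathKernel H x`,

  `Z_H(w,p) · Z_H(w,q) ≤ Z_H(p,q)`.

PROOF (one pendant edge). If `p = w'` (resp. `q = w'`) then `Z_H(w,p) = 0` (resp. `Z_H(w,q) = 0`): a walk of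
`H` from `w` to the isolated vertex `w' ≠ w` would make `w'` non-isolated. Otherwise `w, w', p, q` are pairwise
distinct. Hang the pendant edge on `H`: `G = H ⊔ edge w w' ≤ zdGraph 2`, again with finitely many non-isolated
vertices. In `G` the vertex `w'` is a leaf whose only neighbour is `w`, so every path from `w'` to `q` passes
through `w`, which lies on every path from `w`: the quadruple `(w, w', p, q)` is interlaced, and
`InterlacedTP2At x` gives `Z_G(w,p) Z_G(w',q) ≤ Z_G(w,w') Z_G(p,q)`. Finally `Z_G(w,w') = x` (the only path is
the pendant edge), `Z_G(w',q) ≥ x · Z_H(w,q)` (prepend the pendant edge to a path of `H`), `Z_G(w,p) ≥ Z_H(w,p)`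
(monotonicity of the kernel in the graph) and `Z_G(p,q) ≤ Z_H(p,q)` (a self-avoiding path between non-leaves
never visits the leaf, hence only uses edges of `H`); cancelling `x > 0` gives the claim. The walk lemmas are
the one-leaf versions of those behind the sibling's two-pendant `BoundaryTP2.stub_pendant_threePoint`
(`…Theorems/SAWTotalPositivityBoundaryTP2PendantThreePoint.lean`). Everything here is proved; Mathlib and the
sibling toolkit (`Defs`, `Kernel`, `Symmetry`) only. [folklore]
-/

noncomputable section

open Literature.Probability.LatticeModels
open scoped ENNReal

namespace Summit.CriticalPhenomena.SAWScalingLimit.Theorems.LeftRightFKG.ThreePointPendant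

open Summit.CriticalPhenomena.SAWScalingLimit.Theorems.BoundaryTP2

variable {V : Type*}

/-! ## Walks at a pendant vertex -/

/-- If `ℓ` is a pendant vertex whose only neighbour is `c`, a walk starting at `ℓ` that does not visit `c` is
trivial. [folklore] -/
theorem eq_of_walk_from_leaf {G : SimpleGraph V} {ℓ c : V}
    (hleaf : ∀ z, G.Adj ℓ z → z = c) {v : V} (δ : G.Walk ℓ v) (hc : c ∉ δ.support) : ℓ = v := by
  cases δ with
  | nil => rfl
  | cons h δ' =>
    rw [SimpleGraph.Walk.support_cons, List.mem_cons, not_or] at hc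
    obtain rfl := hleaf _ h
    exact absurd δ'.start_mem_support hc.2

/-- If `ℓ` is a pendant vertex whose only neighbour is `c`, every walk from `ℓ` to another vertex visits `c`.
[folklore] -/
theorem mem_support_of_walk_from_leaf {G : SimpleGraph V} {ℓ c : V}
    (hleaf : ∀ z, G.Adj ℓ z → z = c) {v : V} (δ : G.Walk ℓ v) (hne : ℓ ≠ v) : c ∈ δ.support := by
  by_contra hc
  exact hne (eq_of_walk_from_leaf hleaf δ hc)

/-- A pendant vertex `ℓ` (only neighbour `c`) lying on a self-avoiding path is one of its endpoints: if it is
not the final vertex, it is the initial one. [folklore] -/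
theorem leaf_eq_start_of_mem_support {G : SimpleGraph V} {ℓ c : V}
    (hleaf : ∀ z, G.Adj ℓ z → z = c) :
    ∀ {u v : V} (δ : G.Walk u v), δ.IsPath → ℓ ≠ v → ℓ ∈ δ.support → ℓ = u := by
  intro u v δ
  induction δ with
  | nil =>
    intro _ _ hmem
    rwa [SimpleGraph.Walk.support_nil, List.mem_singleton] at hmem
  | cons h δ' ih =>
    intro hpath hne hmem
    rw [SimpleGraph.Walk.cons_isPath_iff] at hpath
    rw [SimpleGraph.Walk.support_cons, List.mem_cons] at hmem
    rcases hmem with hmem | hmem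
    · exact hmem
    · obtain rfl := ih hpath.1 hne hmem
      obtain rfl := hleaf _ h.symm
      exact absurd (eq_of_walk_from_leaf hleaf δ' hpath.2) hne

/-- The only self-avoiding path from the neighbour `c` of a pendant vertex `ℓ` to `ℓ` is the pendant edge
`c ℓ` itself. [folklore] -/
theorem path_to_leaf_eq {G : SimpleGraph V} {ℓ c : V} (hleaf : ∀ z, G.Adj ℓ z → z = c)
    (hcℓ : G.Adj c ℓ) (δ : G.Walk c ℓ) (hδ : δ.IsPath) :
    δ = SimpleGraph.Walk.cons hcℓ SimpleGraph.Walk.nil := by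
  cases δ with
  | nil => exact absurd rfl hcℓ.ne
  | cons h δ' =>
    rw [SimpleGraph.Walk.cons_isPath_iff] at hδ
    obtain rfl := eq_of_walk_from_leaf hleaf δ'.reverse
      (by rw [SimpleGraph.Walk.support_reverse, List.mem_reverse]; exact hδ.2)
    obtain rfl := (SimpleGraph.Walk.isPath_iff_nil.1 hδ.1).eq_nil
    rfl

/-! ## Comparing path kernels along injections of paths -/

/-- Prepending an edge `ℓ ∼ a` of a supergraph `G ≥ H` to the self-avoiding paths `a → b` of `H`, none of which
visits `ℓ`, is an injection into the self-avoiding paths `ℓ → b` of `G`; hence `x · Z_H(a,b) ≤ Z_G(ℓ,b)` for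
`x ≥ 0`. [folklore] -/
theorem ofReal_mul_pathKernel_le {H G : SimpleGraph V} (hle : H ≤ G) (x : ℝ) (hx : 0 ≤ x)
    {ℓ a b : V} (hadj : G.Adj ℓ a) (hℓ : ∀ γ : H.Walk a b, ℓ ∉ γ.support) :
    ENNReal.ofReal x * pathKernel H x a b ≤ pathKernel G x ℓ b := by
  have hE : ∀ γ : H.Walk a b, ∀ e, e ∈ γ.edges → e ∈ G.edgeSet := fun γ e he =>
    SimpleGraph.edgeSet_mono hle (γ.edges_subset_edgeSet he)
  let f : H.Path a b → G.Path ℓ b := fun γ =>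
    ⟨SimpleGraph.Walk.cons hadj (γ.1.transfer G (hE γ.1)),
      (SimpleGraph.Walk.cons_isPath_iff hadj _).2
        ⟨γ.2.transfer _, by rw [SimpleGraph.Walk.support_transfer]; exact hℓ γ.1⟩⟩
  have hf : Function.Injective f := by
    intro γ γ' h
    have h1 : (SimpleGraph.Walk.cons hadj (γ.1.transfer G (hE γ.1))).support =
        (SimpleGraph.Walk.cons hadj (γ'.1.transfer G (hE γ'.1))).support :=
      congrArg (fun δ : G.Path ℓ b => δ.1.support) h
    rw [SimpleGraph.Walk.support_cons, SimpleGraph.Walk.support_cons, SimpleGraph.Walk.support_transfer,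
      SimpleGraph.Walk.support_transfer, List.cons.injEq] at h1
    exact Subtype.ext (SimpleGraph.Walk.ext_support h1.2)
  calc ENNReal.ofReal x * pathKernel H x a b
      = ∑' γ : H.Path a b, ENNReal.ofReal x * ENNReal.ofReal (x ^ γ.1.length) := by
        rw [pathKernel, ENNReal.tsum_mul_left]
    _ = ∑' γ : H.Path a b, ENNReal.ofReal (x ^ (f γ).1.length) := by
        refine tsum_congr fun γ => ?_
        show ENNReal.ofReal x * ENNReal.ofReal (x ^ γ.1.length) =
          ENNReal.ofReal (x ^ (SimpleGraph.Walk.cons hadj (γ.1.transfer G (hE γ.1))).length)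
        rw [SimpleGraph.Walk.length_cons, SimpleGraph.Walk.length_transfer, pow_succ',
          ENNReal.ofReal_mul hx]
    _ ≤ ∑' δ : G.Path ℓ b, ENNReal.ofReal (x ^ δ.1.length) :=
        ENNReal.tsum_comp_le_tsum_of_injective hf (fun δ : G.Path ℓ b => ENNReal.ofReal (x ^ δ.1.length))
    _ = pathKernel G x ℓ b := rfl

/-- If every self-avoiding path `a → b` of `G` only uses edges of `H`, then `Z_G(a,b) ≤ Z_H(a,b)`:
transferring the paths to `H` is a length-preserving injection. [folklore] -/
theorem pathKernel_le_of_edges {G H : SimpleGraph V} (x : ℝ) {a b : V}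
    (hE : ∀ δ : G.Path a b, ∀ e, e ∈ δ.1.edges → e ∈ H.edgeSet) :
    pathKernel G x a b ≤ pathKernel H x a b := by
  let g : G.Path a b → H.Path a b := fun δ => ⟨δ.1.transfer H (hE δ), δ.2.transfer _⟩
  have hg : Function.Injective g := by
    intro δ δ' h
    have h1 : (δ.1.transfer H (hE δ)).support = (δ'.1.transfer H (hE δ')).support :=
      congrArg (fun γ : H.Path a b => γ.1.support) h
    rw [SimpleGraph.Walk.support_transfer, SimpleGraph.Walk.support_transfer] at h1
    exact Subtype.ext (SimpleGraph.Walk.ext_support h1)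
  calc pathKernel G x a b
      = ∑' δ : G.Path a b, ENNReal.ofReal (x ^ (g δ).1.length) := by
        refine tsum_congr fun δ => ?_
        rw [show (g δ).1.length = δ.1.length from SimpleGraph.Walk.length_transfer _ _]
    _ ≤ ∑' γ : H.Path a b, ENNReal.ofReal (x ^ γ.1.length) :=
        ENNReal.tsum_comp_le_tsum_of_injective hg (fun γ : H.Path a b => ENNReal.ofReal (x ^ γ.1.length))
    _ = pathKernel H x a b := rfl

/-- A walk of a subgraph of `H ⊔ edge w w'` that does not visit `w'` only uses edges of `H`. [folklore] -/
theorem edges_mem_of_notMem {H G : SimpleGraph V} {w w' u v : V}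
    (hG : G ≤ H ⊔ SimpleGraph.edge w w') (δ : G.Walk u v) (hw' : w' ∉ δ.support) :
    ∀ e, e ∈ δ.edges → e ∈ H.edgeSet := by
  intro e he
  have hG' := SimpleGraph.edgeSet_mono hG (δ.edges_subset_edgeSet he)
  rw [SimpleGraph.edgeSet_sup, Set.mem_union] at hG'
  rcases hG' with hG' | hG'
  · exact hG'
  · obtain rfl : e = s(w, w') := Set.mem_singleton_iff.1 (SimpleGraph.edgeSet_edge_subset hG')
    exact absurd (δ.snd_mem_support_of_mem_edges he) hw'

/-- The kernel from a vertex `a` to an isolated vertex `b ≠ a` vanishes: a walk `a → b` would end with an edge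
at `b`. [folklore] -/
theorem pathKernel_eq_zero_of_notMem_support {H : SimpleGraph V} (x : ℝ) {a b : V} (hab : a ≠ b)
    (hb : b ∉ H.support) : pathKernel H x a b = 0 :=
  pathKernel_eq_zero_of_not_reachable H x fun ⟨γ⟩ =>
    (mem_support_walk γ b γ.end_mem_support).elim (fun h => hab h.symm) hb

/-! ## The one-pendant trick -/

/-- **Three-point splitting from interlacing-only TP₂ (one pendant edge).** Assume `InterlacedTP2At x` for
some `x > 0`. Let `H ≤ zdGraph 2` have finitely many non-isolated vertices, let `w ∼ w'` be a lattice edge with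
`w'` isolated in `H`, and let `w, p, q` be pairwise distinct. Then `Z_H(w,p) · Z_H(w,q) ≤ Z_H(p,q)`.
Proof: the cases `p = w'`, `q = w'` are trivial (`Z_H(w,w') = 0`); otherwise in `G = H ⊔ edge w w' ≤ zdGraph 2`
the quadruple `(w, w', p, q)` is interlaced at `w` (the leaf `w'` has `w` as only neighbour), so
`Z_G(w,p) Z_G(w',q) ≤ Z_G(w,w') Z_G(p,q)`; moreover `Z_G(w,w') = x`, `Z_G(w,p) ≥ Z_H(w,p)`,
`Z_G(w',q) ≥ x Z_H(w,q)`, `Z_G(p,q) ≤ Z_H(p,q)`, and `x > 0` cancels. [folklore] -/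
theorem threePoint_of_interlacedTP2At {x : ℝ} (hx : 0 < x) (h : InterlacedTP2At x)
    (H : SimpleGraph (Site 2)) (hH : H ≤ zdGraph 2) (hfin : H.support.Finite) (w w' p q : Site 2)
    (hww' : (zdGraph 2).Adj w w') (hw'H : w' ∉ H.support) (hwp : w ≠ p) (hwq : w ≠ q) (hpq : p ≠ q) :
    pathKernel H x w p * pathKernel H x w q ≤ pathKernel H x p q := by
  -- degenerate cases: `p` or `q` is the isolated vertex `w'`
  by_cases hpw' : p = w'
  · subst hpw'
    rw [pathKernel_eq_zero_of_notMem_support x hwp hw'H, zero_mul]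
    exact zero_le
  by_cases hqw' : q = w'
  · subst hqw'
    rw [pathKernel_eq_zero_of_notMem_support x hwq hw'H, mul_zero]
    exact zero_le
  have hw : w ≠ w' := hww'.ne
  -- the enlarged graph `G`: hang the pendant edge `w w'` on `H`
  obtain ⟨G, hG⟩ : ∃ G : SimpleGraph (Site 2), G = H ⊔ SimpleGraph.edge w w' := ⟨_, rfl⟩
  have hGadj : ∀ a b : Site 2, G.Adj a b ↔ H.Adj a b ∨ (a = w ∧ b = w' ∨ a = w' ∧ b = w) ∧ a ≠ b :=
    fun a b => by rw [hG, SimpleGraph.sup_adj, SimpleGraph.edge_adj]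
  have hle : H ≤ G := by rw [hG]; exact le_sup_left
  have hGzd : G ≤ zdGraph 2 := by
    rw [hG]
    exact sup_le hH ((SimpleGraph.edge_le_iff _).2 (Or.inr hww'))
  have hw'w : G.Adj w' w := (hGadj w' w).2 (Or.inr ⟨Or.inr ⟨rfl, rfl⟩, hw.symm⟩)
  -- in `G`, the leaf `w'` has `w` as its only neighbour
  have hleaf : ∀ z, G.Adj w' z → z = w := by
    intro z hz
    rcases (hGadj w' z).1 hz with hz | ⟨⟨h1, h2⟩ | ⟨-, h2⟩, -⟩
    · exact (hw'H hz.mem_support_left).elim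
    · exact h2.trans h1
    · exact h2
  -- `G ≤ zdGraph 2` has finitely many non-isolated vertices
  have hsupp : G.support ⊆ H.support ∪ {w, w'} := by
    intro v hv
    obtain ⟨z, hz⟩ := (SimpleGraph.mem_support G).1 hv
    simp only [Set.mem_union, Set.mem_insert_iff, Set.mem_singleton_iff]
    rcases (hGadj v z).1 hz with hz | ⟨⟨h1, -⟩ | ⟨h1, -⟩, -⟩
    · exact Or.inl hz.mem_support_left
    · exact Or.inr (Or.inl h1)
    · exact Or.inr (Or.inr h1)
  have hfinG : G.support.Finite := (hfin.union ((Set.finite_singleton w').insert w)).subset hsupp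
  -- the quadruple `(w, w', p, q)` is interlaced in `G` (at `w`), so `InterlacedTP2At x` applies
  have hint : Interlaced G w w' p q := fun P Q =>
    ⟨w, P.1.start_mem_support, mem_support_of_walk_from_leaf hleaf Q.1 (Ne.symm hqw')⟩
  have key : pathKernel G x w p * pathKernel G x w' q ≤ pathKernel G x w w' * pathKernel G x p q :=
    h G hGzd hfinG w w' p q hw hwp hwq (Ne.symm hpw') (Ne.symm hqw') hpq hint
  -- `Z_H(w,p) ≤ Z_G(w,p)` and `x · Z_H(w,q) ≤ Z_G(w',q)`
  have hA : pathKernel H x w p ≤ pathKernel G x w p := pathKernel_mono hle x w p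
  have hA' : ENNReal.ofReal x * pathKernel H x w q ≤ pathKernel G x w' q :=
    ofReal_mul_pathKernel_le hle x hx.le hw'w fun γ hmem =>
      (mem_support_walk γ w' hmem).elim (fun h' => hw h'.symm) hw'H
  -- `Z_G(w,w') = x`: the only self-avoiding path is the pendant edge
  have hB : pathKernel G x w w' ≤ ENNReal.ofReal x := by
    have hP₀ : (SimpleGraph.Walk.cons hw'w.symm SimpleGraph.Walk.nil : G.Walk w w').IsPath := by
      refine (SimpleGraph.Walk.cons_isPath_iff _ _).2 ⟨SimpleGraph.Walk.IsPath.nil, fun h' => hw ?_⟩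
      rwa [SimpleGraph.Walk.support_nil, List.mem_singleton] at h'
    have huniq : ∀ δ : G.Path w w', δ = ⟨_, hP₀⟩ := fun δ =>
      Subtype.ext (path_to_leaf_eq hleaf hw'w.symm δ.1 δ.2)
    rw [pathKernel, tsum_eq_single _ fun δ hδ => absurd (huniq δ) hδ]
    show ENNReal.ofReal (x ^ 1) ≤ ENNReal.ofReal x
    rw [pow_one]
  -- `Z_G(p,q) ≤ Z_H(p,q)`: a self-avoiding path `p → q` of `G` avoids the leaf `w'`, hence lies in `H`
  have hC : pathKernel G x p q ≤ pathKernel H x p q :=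
    pathKernel_le_of_edges x fun δ => edges_mem_of_notMem hG.le δ.1 fun hm =>
      hpw' (leaf_eq_start_of_mem_support hleaf δ.1 δ.2 (Ne.symm hqw') hm).symm
  -- assemble and cancel `x > 0`
  rw [← ENNReal.mul_le_mul_iff_right (ENNReal.ofReal_pos.2 hx).ne' ENNReal.ofReal_ne_top]
  calc ENNReal.ofReal x * (pathKernel H x w p * pathKernel H x w q)
      = pathKernel H x w p * (ENNReal.ofReal x * pathKernel H x w q) := mul_left_comm _ _ _
    _ ≤ pathKernel G x w p * pathKernel G x w' q := mul_le_mul' hA hA'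
    _ ≤ pathKernel G x w w' * pathKernel G x p q := key
    _ ≤ ENNReal.ofReal x * pathKernel H x p q := mul_le_mul' hB hC

/-- REGISTERED STUB `stub_threePointOfInterlaced` of line `corner-localisation` (skeleton v7, lead c2):
`InterlacedTP2At x` implies the three-point splitting inequality at every `0 < x`, verbatim the registered
signature (`threePoint_of_interlacedTP2At`, the one-pendant trick). [folklore] -/
theorem stub_threePointOfInterlaced : ∀ x : ℝ, 0 < x → BoundaryTP2.InterlacedTP2At x →
    ∀ H : SimpleGraph (Site 2), H ≤ zdGraph 2 → H.support.Finite →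
      ∀ w w' p q : Site 2, (zdGraph 2).Adj w w' → w' ∉ H.support → w ≠ p → w ≠ q → p ≠ q →
        BoundaryTP2.pathKernel H x w p * BoundaryTP2.pathKernel H x w q ≤ BoundaryTP2.pathKernel H x p q :=
  fun _ hx h H hH hfin w w' p q hww' hw'H hwp hwq hpq =>
    threePoint_of_interlacedTP2At hx h H hH hfin w w' p q hww' hw'H hwp hwq hpq

end Summit.CriticalPhenomena.SAWScalingLimit.Theorems.LeftRightFKG.ThreePointPendant

end
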